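import Literature.Algebra.Homology.OrderedCechContraction
import Literature.Algebra.Homology.OrderedCechMap
import Mathlib.Algebra.Homology.HomologySequenceLemmas
import HarnessLib

/-!
# Koszul kernels in ordered Čech complexes: the exact sequences of the exterior powers of a
# split surjection, and the two-out-of-three passage of quasi-isomorphisms to the kernels

[topic Algebra/Homology]

This is the homological engine of Serre's dévissage in GAGA (Serre 1956, n° 13: Théorème 1 for
`𝒪(n)` — Lemme 5 — implies Théorème 1 for every coherent sheaf through exact sequences of sheaves,
the two long exact cohomology sequences and the five lemma) in the special case used for the
sheaves of twisted differential forms `Ω^p_{ℙ_r}(n)`: these are the KERNELS (cycles) of the Koszul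
complex of the coordinates `x₀, …, x_r` acting on the free sheaves `Λ^q 𝒪(-1)^{r+1} = 𝒪(-q)^{(r+1 choose q)}`
— the exterior powers of the Euler sequence, Okonek–Schneider–Spindler, Ch. I §1.1 (3):
`0 → Ω^q(q) → 𝒪^{(r+1 choose q)} → Ω^{q-1}(q) → 0` — and on every standard affine piece
`U_s = {x_i ≠ 0, i ∈ s}` (`s ≠ ∅`) the Koszul complex is split by the cone `h = x_{i₀}⁻¹ e_{i₀} ∧ ·`,
`i₀ ∈ s` (Görtz–Wedhorn II, Rem. 22.87: for a surjective `u` the Koszul complex `K(u)` is homotopy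
equivalent to `0` on affines where `u` has a section).

Abstractly (everything with Mathlib primitives and the tree's ordered Čech complex
`Literature.Algebra.Homology.OrderedCech`): let `R` be a commutative `A`-algebra, `M` an
`R`-module, `x : ι → R` and `u : ι → R` with `u_i x_i = 1` (`ι` a finite linear order).

* `KoszulCech.Sub ι q` — the `q`-subsets `I ⊆ ι`; the module of Koszul `q`-chains with values in
  `M` is `Sub ι q → M` (coordinates `v_I`, `#I = q` — the format `J → 𝕂` of the tree's free
  graded modules `LaurentCech.cech e ⊤ n` / `GAGAFree`, which is why the tree's alternating-map
  model `RingTheory/Koszul/Alternating` is not used here);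
* `KoszulCech.kd x q : (Sub ι (q+1) → M) →ₗ[R] (Sub ι q → M)` — the Koszul differential
  `(∂v)_I = Σ_{i ∉ I} ε(I ∪ i, i) x_i v_{I ∪ i}`; `KoszulCech.kh u i₀ q` — the cone
  `(h w)_K = ε(K, i₀) u w_{K ∖ i₀}`; the identities `∂h + h∂ = u x_{i₀}` (`kd_kh_add_kh_kd`,
  `kd_kh_zero`), `∂∂ = 0` (`kd_kd`), the cycles `KoszulCech.cycles x q` (`Z_0 = C_0`,
  `Z_{q+1} = ker ∂`) and `∂ (h w) = w` for `w ∈ Z_q` when `u x_{i₀} = 1` (`kd_kh_of_mem_cycles`);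
  naturality in `M` along `R`-linear maps (`kd_compLeft`, `kh_compLeft`);
* `KoszulCech.Datum` — for every `q` a monotone family `G q : Finset ι → Submodule A (Sub ι q → M)`
  of "sections over `U_s`" stable under `∂` and, for `i ∈ s`, under the cone `h_{u_i, i}`, together
  with the kernel families `E q s = G q s ∩ Z_q`; its **short exact sequences of ordered Čech
  complexes** `0 → Č(E (q+1)) → Č(G (q+1)) → Č(E q) → 0` (`Datum.shortExact_ses`: surjectivity on
  each `U_s`, `s ≠ ∅`, by the cone from a vertex `i ∈ s`);
* `KoszulCech.Datum.Hom` — an `R`-linear `ψ : M → M'` carrying `G q s` into `G' q s`; the induced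
  comparison maps of free complexes `freeMap q : Č(G q) → Č(G' q)` and of kernel complexes
  `kerMap q : Č(E q) → Č(E' q)`, and the main result
  **`KoszulCech.Datum.Hom.quasiIso_kerMap`: if every `freeMap q` is a quasi-isomorphism, so is every
  `kerMap q`** — by DESCENDING induction on `q` (for `q > #ι` all complexes vanish), each step being
  Mathlib's two-out-of-three lemma `HomologicalComplex.HomologySequence.quasiIso_τ₃` for the morphism
  of short exact sequences `sesMap q` (the long exact cohomology sequences and the five lemma, as in
  Serre's n° 13).

The instantiation — `M = ℂ[x^{±1}]` resp. `𝕂 = Γ(T, 𝒪)` with Serre's algebraic resp. holomorphic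
section families, `ψ` = evaluation, giving GAGA Théorème 1 for `Ω^p_{ℙ_r}(n)` — is
`Literature/AlgebraicGeometry/HodgeTheory/GAGADifferentialFormsProjectiveSpace.lean`.
Everything here is proved; definitions with bodies; no named facts (net debt 0).

## References

* [SerreGAGA1956] J.-P. Serre, *Géométrie algébrique et géométrie analytique*, Ann. Inst. Fourier 6
  (1956), n° 13 (proof of Théorème 1: Lemme 5, "lemme des cinq", "récurrence descendante sur q").
* [OkonekSchneiderSpindler1980] C. Okonek, M. Schneider, H. Spindler, *Vector Bundles on Complex
  Projective Spaces*, Progress in Math. 3 (1980), Ch. I §1.1, (2)–(3) (Euler sequence and its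
  exterior powers).
* [GortzWedhorn2023] U. Görtz, T. Wedhorn, *Algebraic Geometry II*, (19.1) Def. 19.1 (Koszul
  complex), Rem. 22.87 and the proof of Thm. 22.86 (the Koszul complex of `π^*𝓔(-1) → 𝒪` on
  `ℙ(𝓔)`; homotopy equivalent to `0` where `u` has a section), Def. 21.68 (ordered Čech complex).
-/

noncomputable section

universe u v w

open CategoryTheory Finset

namespace Literature.Algebra.Homology

namespace KoszulCech

open OrderedCech

/-! ### `q`-subsets and evaluation of chains -/

section Sub

variable {ι : Type}

/-- The `q`-element subsets of `ι` (indexing the basis `e_I`, `#I = q`, of `Λ^q R^ι`).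
[cite: GortzWedhorn2023, (19.1) Def. 19.1] -/
abbrev Sub (ι : Type) (q : ℕ) : Type := {I : Finset ι // I.card = q}

/-- There are no `q`-subsets for `q > #ι`. [cite: GortzWedhorn2023, (19.1) Def. 19.1] -/
theorem isEmpty_sub_of_card_lt [Fintype ι] {q : ℕ} (hq : Fintype.card ι < q) : IsEmpty (Sub ι q) :=
  ⟨fun I => absurd (I.2 ▸ Finset.card_le_univ I.1) (not_le.2 hq)⟩

variable {R : Type u} [CommRing R] {M : Type v} [AddCommGroup M] [Module R M]

/-- Evaluation of a `q`-chain at an arbitrary finite set `K`: `v_K` if `#K = q`, else `0` (as a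
linear map; the device `Cochain.ext0` of `OrderedCech`). [folklore] -/
def extL (R : Type u) [CommRing R] {M : Type v} [AddCommGroup M] [Module R M] (q : ℕ)
    (K : Finset ι) : (Sub ι q → M) →ₗ[R] M :=
  if h : K.card = q then LinearMap.proj (⟨K, h⟩ : Sub ι q) else 0

/-- `extL` on a set of the right size. [cite: GortzWedhorn2023, (19.1) Def. 19.1] -/
theorem extL_apply_of_eq {q : ℕ} {K : Finset ι} (h : K.card = q) (v : Sub ι q → M) :
    extL R q K v = v ⟨K, h⟩ := by
  unfold extL; rw [dif_pos h]; rfl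

/-- `extL` on a set of the wrong size. [cite: GortzWedhorn2023, (19.1) Def. 19.1] -/
theorem extL_apply_of_ne {q : ℕ} {K : Finset ι} (h : K.card ≠ q) (v : Sub ι q → M) :
    extL R q K v = 0 := by
  unfold extL; rw [dif_neg h]; rfl

/-- `extL` at a `q`-subset is the coordinate. [cite: GortzWedhorn2023, (19.1) Def. 19.1] -/
@[simp] theorem extL_val {q : ℕ} (I : Sub ι q) (v : Sub ι q → M) : extL R q I.1 v = v I :=
  extL_apply_of_eq I.2 v

/-- `extL` is natural in `M`. [cite: GortzWedhorn2023, (19.1) Def. 19.1] -/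
theorem extL_comp {M' : Type v} [AddCommGroup M'] [Module R M'] (ψ : M →ₗ[R] M') (q : ℕ)
    (K : Finset ι) (v : Sub ι q → M) : extL R q K (ψ ∘ v) = ψ (extL R q K v) := by
  by_cases h : K.card = q
  · rw [extL_apply_of_eq h, extL_apply_of_eq h]; rfl
  · rw [extL_apply_of_ne h, extL_apply_of_ne h, map_zero]

end Sub

/-! ### The Koszul differential and the cone from a vertex -/

section Koszul

variable {ι : Type} [LinearOrder ι] [Fintype ι]
variable {R : Type u} [CommRing R] {M : Type v} [AddCommGroup M] [Module R M]
variable (x : ι → R)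

/-- **The Koszul differential** `∂ : C_{q+1} → C_q` of `x = (x_i)`,
`(∂ v)_I = Σ_{i ∉ I} ε(I ∪ i, i) x_i v_{I ∪ i}`, `ε(s, a) = (-1)^{#{b ∈ s, b < a}}` the sign of
`OrderedCech` (the terms with `i ∈ I` vanish since then `#(I ∪ i) ≠ q + 1`).
[cite: GortzWedhorn2023, (19.1) Def. 19.1] -/
def kd (q : ℕ) : (Sub ι (q + 1) → M) →ₗ[R] (Sub ι q → M) :=
  LinearMap.pi fun I => ∑ i, (sign R (insert i I.1) i * x i) • extL R (q + 1) (insert i I.1)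

/-- The coordinates of `∂ v`. [cite: GortzWedhorn2023, (19.1) Def. 19.1] -/
theorem kd_apply (q : ℕ) (v : Sub ι (q + 1) → M) (I : Sub ι q) :
    kd x q v I = ∑ i, (sign R (insert i I.1) i * x i) • extL R (q + 1) (insert i I.1) v := by
  simp [kd, LinearMap.pi_apply, LinearMap.sum_apply, LinearMap.smul_apply]

/-- `extL` of `∂ v` at a set of size `q`. [cite: GortzWedhorn2023, (19.1) Def. 19.1] -/
theorem extL_kd (q : ℕ) (v : Sub ι (q + 1) → M) {I : Finset ι} (hI : I.card = q) :
    extL R q I (kd x q v) = ∑ i, (sign R (insert i I) i * x i) • extL R (q + 1) (insert i I) v := by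
  rw [extL_apply_of_eq hI, kd_apply]

/-- **`∂ ∂ = 0`** (the signs of the two ways of inserting `i ≠ j` cancel,
`OrderedCech.sign_mul_sign_erase_add`). [cite: GortzWedhorn2023, (19.1) Def. 19.1] -/
theorem kd_kd (q : ℕ) (v : Sub ι (q + 2) → M) : kd x q (kd x (q + 1) v) = 0 := by
  funext I
  rw [kd_apply, Pi.zero_apply]
  obtain ⟨I, hI⟩ := I
  dsimp only
  -- expand every summand into a sum over `j`
  set F : ι → ι → M := fun i j =>
    (sign R (insert i I) i * x i * (sign R (insert j (insert i I)) j * x j)) •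
      extL R (q + 2) (insert j (insert i I)) v with hF
  have hterm : ∀ i, (sign R (insert i I) i * x i) • extL R (q + 1) (insert i I) (kd x (q + 1) v) =
      ∑ j, F i j := by
    intro i
    by_cases hiI : i ∈ I
    · rw [Finset.insert_eq_of_mem hiI, extL_apply_of_ne (by rw [hI]; omega), smul_zero]
      symm
      refine Finset.sum_eq_zero fun j _ => ?_
      rw [hF]
      dsimp only
      rw [Finset.insert_eq_of_mem hiI, extL_apply_of_ne, smul_zero]
      have := Finset.card_insert_le j I
      omega
    · rw [extL_kd x (q + 1) v (by rw [Finset.card_insert_of_notMem hiI, hI]), Finset.smul_sum]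
      refine Finset.sum_congr rfl fun j _ => ?_
      rw [hF, smul_smul]
  simp_rw [hterm]
  rw [← Finset.sum_product' (f := F)]
  -- the involution `(i, j) ↦ (j, i)`
  have hdiag : ∀ i, F i i = 0 := by
    intro i
    rw [hF]
    dsimp only
    rw [Finset.insert_eq_of_mem (Finset.mem_insert_self i I), extL_apply_of_ne, smul_zero]
    have := Finset.card_insert_le i I
    omega
  have hanti : ∀ i j, F i j + F j i = 0 := by
    intro i j
    rcases eq_or_ne i j with rfl | hij
    · rw [hdiag, add_zero]
    by_cases hiI : i ∈ I
    · have h1 : F i j = 0 := by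
        rw [hF]; dsimp only
        rw [Finset.insert_eq_of_mem hiI, extL_apply_of_ne, smul_zero]
        have := Finset.card_insert_le j I
        omega
      have h2 : F j i = 0 := by
        rw [hF]; dsimp only
        rw [Finset.insert_eq_of_mem (Finset.mem_insert_of_mem hiI), extL_apply_of_ne, smul_zero]
        have := Finset.card_insert_le j I
        omega
      rw [h1, h2, add_zero]
    by_cases hjI : j ∈ I
    · have h1 : F i j = 0 := by
        rw [hF]; dsimp only
        rw [Finset.insert_eq_of_mem (Finset.mem_insert_of_mem hjI), extL_apply_of_ne, smul_zero]
        have := Finset.card_insert_le i I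
        omega
      have h2 : F j i = 0 := by
        rw [hF]; dsimp only
        rw [Finset.insert_eq_of_mem hjI, extL_apply_of_ne, smul_zero]
        have := Finset.card_insert_le i I
        omega
      rw [h1, h2, add_zero]
    -- `i ≠ j`, both outside `I`
    rw [hF]; dsimp only
    rw [Finset.insert_comm j i I, ← add_smul]
    set K := insert i (insert j I) with hK
    have hiK : i ∈ K := Finset.mem_insert_self _ _
    have hjK : j ∈ K := Finset.mem_insert_of_mem (Finset.mem_insert_self _ _)
    have hKi : K.erase i = insert j I := by
      rw [hK, Finset.erase_insert]
      exact fun h => (Finset.mem_insert.1 h).elim hij hiI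
    have hKj : K.erase j = insert i I := by
      rw [hK, Finset.insert_comm, Finset.erase_insert]
      exact fun h => (Finset.mem_insert.1 h).elim (Ne.symm hij) hjI
    have key := sign_mul_sign_erase_add (A := R) hiK hjK hij
    rw [hKi, hKj] at key
    have : sign R (insert i I) i * x i * (sign R K j * x j) +
        sign R (insert j I) j * x j * (sign R K i * x i) = 0 := by
      linear_combination (x i * x j) * key
    rw [this, zero_smul]
  exact Finset.sum_ninvolution (fun p => (p.2, p.1)) (fun p => hanti p.1 p.2)
    (fun p hp h => hp (by
      have h1 : p.2 = p.1 := congrArg Prod.fst h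
      change F p.1 p.2 = 0
      rw [← h1]
      exact hdiag p.2))
    (fun p => Finset.mem_product.2 ⟨Finset.mem_univ _, Finset.mem_univ _⟩) (fun p => rfl)

variable (u : R) (i₀ : ι)

omit [Fintype ι] in
/-- **The cone from the vertex `i₀`**: `(h w)_K = ε(K, i₀) u w_{K ∖ i₀}` (zero unless `i₀ ∈ K`;
on the affine piece `x_{i₀} ≠ 0` with `u = x_{i₀}⁻¹` this is the homotopy `x_{i₀}⁻¹ e_{i₀} ∧ ·`
contracting the Koszul complex). [cite: GortzWedhorn2023, Rem. 22.87] -/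
def kh (q : ℕ) : (Sub ι q → M) →ₗ[R] (Sub ι (q + 1) → M) :=
  LinearMap.pi fun K => (sign R K.1 i₀ * u) • extL R q (K.1.erase i₀)

omit [Fintype ι] in
/-- The coordinates of `h w`. [cite: GortzWedhorn2023, Rem. 22.87] -/
theorem kh_apply (q : ℕ) (w : Sub ι q → M) (K : Sub ι (q + 1)) :
    kh u i₀ q w K = (sign R K.1 i₀ * u) • extL R q (K.1.erase i₀) w := by
  simp [kh, LinearMap.pi_apply, LinearMap.smul_apply]

omit [Fintype ι] in
/-- `extL` of `h w` at a set containing `i₀`. [cite: GortzWedhorn2023, Rem. 22.87] -/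
theorem extL_kh_of_mem (q : ℕ) (w : Sub ι q → M) {K : Finset ι} (hK : i₀ ∈ K) :
    extL R (q + 1) K (kh u i₀ q w) = (sign R K i₀ * u) • extL R q (K.erase i₀) w := by
  by_cases h : K.card = q + 1
  · rw [extL_apply_of_eq h, kh_apply]
  · rw [extL_apply_of_ne h, extL_apply_of_ne, smul_zero]
    intro h'
    apply h
    rw [← Finset.card_erase_add_one hK, h']

omit [Fintype ι] in
/-- `extL` of `h w` at a set not containing `i₀` vanishes. [cite: GortzWedhorn2023, Rem. 22.87] -/
theorem extL_kh_of_not_mem (q : ℕ) (w : Sub ι q → M) {K : Finset ι} (hK : i₀ ∉ K) :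
    extL R (q + 1) K (kh u i₀ q w) = 0 := by
  by_cases h : K.card = q + 1
  · rw [extL_apply_of_eq h, kh_apply, Finset.erase_eq_of_notMem hK, extL_apply_of_ne, smul_zero]
    omega
  · rw [extL_apply_of_ne h]

/-- **The cone identity** `∂ h + h ∂ = u x_{i₀}` on `C_{q+1}` (the Koszul complex of a sequence
containing a unit is contractible). [cite: GortzWedhorn2023, Rem. 22.87] -/
theorem kd_kh_add_kh_kd (q : ℕ) (v : Sub ι (q + 1) → M) :
    kd x (q + 1) (kh u i₀ (q + 1) v) + kh u i₀ q (kd x q v) = (u * x i₀) • v := by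
  funext I
  rw [Pi.add_apply, Pi.smul_apply, kd_apply, kh_apply]
  obtain ⟨I, hI⟩ := I
  dsimp only
  by_cases h0 : i₀ ∈ I
  · -- `i₀ ∈ I`
    have hcard : (I.erase i₀).card = q := by rw [Finset.card_erase_of_mem h0, hI]; rfl
    rw [extL_kd x q v hcard, Finset.smul_sum, ← Finset.sum_add_distrib]
    rw [← Finset.add_sum_erase _ _ (Finset.mem_univ i₀)]
    have hins : insert i₀ (I.erase i₀) = I := Finset.insert_erase h0
    rw [hins, Finset.insert_eq_of_mem h0, extL_apply_of_ne (by rw [hI]; omega), smul_zero, zero_add,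
      extL_apply_of_eq hI, smul_smul]
    rw [Finset.sum_eq_zero, add_zero]
    · congr 1
      have h1 := sign_mul_sign_self (A := R) I i₀
      linear_combination (x i₀ * u) * h1
    · intro i hi
      rw [Finset.mem_erase] at hi
      obtain ⟨hi0, -⟩ := hi
      by_cases hiI : i ∈ I
      · rw [Finset.insert_eq_of_mem hiI, extL_apply_of_ne (by rw [hI]; omega), smul_zero, zero_add,
          Finset.insert_eq_of_mem (Finset.mem_erase.2 ⟨hi0, hiI⟩),
          extL_apply_of_ne (by rw [hcard]; omega), smul_zero, smul_zero]
      · rw [extL_kh_of_mem u i₀ (q + 1) v (Finset.mem_insert_of_mem h0), smul_smul,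
          Finset.erase_insert_of_ne hi0, smul_smul, ← add_smul]
        have key := sign_cone_add (A := R) h0 hiI
        have : sign R (insert i I) i * x i * (sign R (insert i I) i₀ * u) +
            sign R I i₀ * u * (sign R (insert i (I.erase i₀)) i * x i) = 0 := by
          linear_combination (x i * u) * key
        rw [this, zero_smul]
  · -- `i₀ ∉ I`
    rw [Finset.erase_eq_of_notMem h0, extL_apply_of_ne (by rw [hI]; omega), smul_zero, add_zero]
    rw [Finset.sum_eq_single i₀]
    · rw [extL_kh_of_mem u i₀ (q + 1) v (Finset.mem_insert_self i₀ I), Finset.erase_insert h0,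
        extL_apply_of_eq hI, smul_smul]
      congr 1
      have h1 := sign_mul_sign_self (A := R) (insert i₀ I) i₀
      linear_combination (x i₀ * u) * h1
    · intro i _ hi
      rw [extL_kh_of_not_mem u i₀ (q + 1) v, smul_zero]
      rw [Finset.mem_insert, not_or]
      exact ⟨Ne.symm hi, h0⟩
    · intro h; exact absurd (Finset.mem_univ i₀) h

/-- **The cone identity in degree `0`**: `∂ h = u x_{i₀}` on `C_0`. [cite: GortzWedhorn2023, Rem. 22.87] -/
theorem kd_kh_zero (v : Sub ι 0 → M) : kd x 0 (kh u i₀ 0 v) = (u * x i₀) • v := by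
  funext I
  rw [Pi.smul_apply, kd_apply]
  obtain ⟨I, hI⟩ := I
  have hI' : I = ∅ := Finset.card_eq_zero.1 hI
  subst hI'
  dsimp only
  rw [Finset.sum_eq_single i₀]
  · rw [extL_kh_of_mem u i₀ 0 v (Finset.mem_insert_self i₀ ∅), Finset.erase_insert (by simp),
      extL_apply_of_eq hI, smul_smul]
    congr 1
    have h1 := sign_mul_sign_self (A := R) (insert i₀ (∅ : Finset ι)) i₀
    linear_combination (x i₀ * u) * h1
  · intro i _ hi
    rw [extL_kh_of_not_mem u i₀ 0 v, smul_zero]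
    simpa using Ne.symm hi
  · intro h; exact absurd (Finset.mem_univ i₀) h

/-! ### Cycles -/

/-- **The Koszul cycles** `Z_q ⊆ C_q`: `Z_0 = C_0` and `Z_{q+1} = ker (∂ : C_{q+1} → C_q)`.
[cite: GortzWedhorn2023, (19.1) Def. 19.1] -/
def cycles : (q : ℕ) → Submodule R (Sub ι q → M)
  | 0 => ⊤
  | q + 1 => LinearMap.ker (kd (M := M) x q)

/-- Every `0`-chain is a cycle. [cite: GortzWedhorn2023, (19.1) Def. 19.1] -/
theorem mem_cycles_zero (v : Sub ι 0 → M) : v ∈ cycles (M := M) x 0 := trivial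

/-- Cycles in positive degree. [cite: GortzWedhorn2023, (19.1) Def. 19.1] -/
theorem mem_cycles_succ {q : ℕ} {v : Sub ι (q + 1) → M} :
    v ∈ cycles x (q + 1) ↔ kd x q v = 0 :=
  LinearMap.mem_ker

/-- `∂` lands in the cycles. [cite: GortzWedhorn2023, (19.1) Def. 19.1] -/
theorem kd_mem_cycles {q : ℕ} (v : Sub ι (q + 1) → M) : kd x q v ∈ cycles x q := by
  cases q with
  | zero => exact mem_cycles_zero x _
  | succ q => exact (mem_cycles_succ x).2 (kd_kd x q v)

/-- **A cycle is the boundary of its cone**: for `w ∈ Z_q` and `u x_{i₀} = 1`, `∂ (h w) = w`.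
[cite: GortzWedhorn2023, Rem. 22.87] -/
theorem kd_kh_of_mem_cycles (hu : u * x i₀ = 1) {q : ℕ} {w : Sub ι q → M}
    (hw : w ∈ cycles x q) : kd x q (kh u i₀ q w) = w := by
  cases q with
  | zero => rw [kd_kh_zero, hu, one_smul]
  | succ q =>
    have h := kd_kh_add_kh_kd x u i₀ q w
    rw [(mem_cycles_succ x).1 hw, map_zero, add_zero, hu, one_smul] at h
    exact h

/-! ### Naturality in the module -/

variable {M' : Type v} [AddCommGroup M'] [Module R M'] (ψ : M →ₗ[R] M')

omit [LinearOrder ι] [Fintype ι] in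
/-- `ψ.compLeft I v = ψ ∘ v`. [folklore] -/
private theorem compLeft_eq {I : Type} (v : I → M) : ψ.compLeft I v = ψ ∘ v := rfl

/-- **`∂` is natural** along `R`-linear maps `ψ : M → M'` (applied coordinatewise).
[cite: GortzWedhorn2023, Rem. 19.5 (1)] -/
theorem kd_compLeft (q : ℕ) (v : Sub ι (q + 1) → M) :
    kd x q (ψ.compLeft (Sub ι (q + 1)) v) = ψ.compLeft (Sub ι q) (kd x q v) := by
  funext I
  rw [compLeft_eq, compLeft_eq, kd_apply, Function.comp_apply, kd_apply, map_sum]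
  refine Finset.sum_congr rfl fun i _ => ?_
  rw [map_smul, extL_comp]

omit [Fintype ι] in
/-- **The cone is natural** along `R`-linear maps. [cite: GortzWedhorn2023, Rem. 19.5 (1)] -/
theorem kh_compLeft (q : ℕ) (w : Sub ι q → M) :
    kh u i₀ q (ψ.compLeft (Sub ι q) w) = ψ.compLeft (Sub ι (q + 1)) (kh u i₀ q w) := by
  funext K
  rw [compLeft_eq, compLeft_eq, kh_apply, Function.comp_apply, kh_apply, map_smul, extL_comp]

/-- Cycles map to cycles. [cite: GortzWedhorn2023, Rem. 19.5 (1)] -/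
theorem compLeft_mem_cycles {q : ℕ} {v : Sub ι q → M} (hv : v ∈ cycles x q) :
    ψ.compLeft (Sub ι q) v ∈ cycles (M := M') x q := by
  cases q with
  | zero => exact mem_cycles_zero x _
  | succ q =>
    rw [mem_cycles_succ] at hv ⊢
    rw [kd_compLeft, hv, map_zero]

end Koszul

/-! ### Families of sections stable under the Koszul complex; the short exact sequences -/

section Families

variable {ι : Type} [LinearOrder ι] [Fintype ι]
variable {A : Type w} [CommRing A] {R : Type u} [CommRing R]
variable {M : Type v} [AddCommGroup M] [Module R M] [Module A M]
variable (x u : ι → R)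

variable (A M) in
/-- **A Koszul–Čech datum**: for every `q` a monotone family `s ↦ G q s` of `A`-submodules of the
Koszul `q`-chains `Sub ι q → M` ("the sections `Γ(U_s, Λ^q)`"), stable under `∂` and, for `i ∈ s`,
under the cone `h_{u_i, i}` ("`x_i` is invertible on `U_s`"), together with the kernel families
`E q s = G q s ∩ Z_q` ("the sections `Γ(U_s, ker ∂)`"), recorded as data with their membership
characterisation so that the user's own description of the kernels is definitionally the one the
complexes are built on. [cite: SerreGAGA1956, n° 13] [cite: GortzWedhorn2023, Rem. 22.87] -/
structure Datum where
  /-- The free families `Γ(U_s, Λ^q)`. -/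
  G : (q : ℕ) → Finset ι → Submodule A (Sub ι q → M)
  /-- Restriction is inclusion. -/
  monoG : ∀ q, Monotone (G q)
  /-- The kernel families `Γ(U_s, Z_q)`. -/
  E : (q : ℕ) → Finset ι → Submodule A (Sub ι q → M)
  /-- Restriction is inclusion. -/
  monoE : ∀ q, Monotone (E q)
  /-- The kernel family is the free family cut by the cycles. -/
  mem_E : ∀ q s v, v ∈ E q s ↔ v ∈ G q s ∧ v ∈ cycles x q
  /-- `∂` preserves the sections. -/
  kd_mem : ∀ q s, ∀ v ∈ G (q + 1) s, kd x q v ∈ G q s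
  /-- On `U_s`, `s ∋ i`, the cone `h_{u_i, i}` preserves the sections. -/
  kh_mem : ∀ q s i, i ∈ s → ∀ w ∈ G q s, kh (u i) i q w ∈ G (q + 1) s

namespace Datum

variable {x u} (D : Datum A M x u)

/-- `E q s ≤ G q s`. [cite: SerreGAGA1956, n° 13] -/
theorem E_le_G (q : ℕ) (s : Finset ι) : D.E q s ≤ D.G q s := fun _ hv => ((D.mem_E q s _).1 hv).1

/-- The ordered Čech complex `Č(G q)` of the free family. [cite: GortzWedhorn2023, Def. 21.68] -/
def freeCx (q : ℕ) : CochainComplex (ModuleCat.{v} A) ℤ := complex (D.G q) (D.monoG q)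

/-- The ordered Čech complex `Č(E q)` of the kernel family. [cite: GortzWedhorn2023, Def. 21.68] -/
def kerCx (q : ℕ) : CochainComplex (ModuleCat.{v} A) ℤ := complex (D.E q) (D.monoE q)

/-! ### Vanishing beyond the top degree -/

/-- For `q > #ι` every term of `Č(E q)` is a zero object (there are no `q`-chains). [cite: SerreGAGA1956, n° 13] -/
theorem isZero_kerCx_X {q : ℕ} (hq : Fintype.card ι < q) (n : ℤ) : Limits.IsZero ((D.kerCx q).X n) := by
  haveI := isEmpty_sub_of_card_lt (ι := ι) hq
  haveI : Subsingleton (Cochain (D.E q) n) :=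
    inferInstanceAs (Subsingleton (∀ σ : Simplex ι n, D.E q σ.1))
  exact ModuleCat.isZero_of_subsingleton (ModuleCat.of A (Cochain (D.E q) n))

end Datum

/-! ### The short exact sequences -/

variable [Algebra A R] [IsScalarTower A R M]

variable (A) in
/-- `∂` as an `A`-linear map. [folklore] -/
abbrev kdA (q : ℕ) : (Sub ι (q + 1) → M) →ₗ[A] (Sub ι q → M) := (kd (M := M) x q).restrictScalars A

namespace Datum

variable {x u} (D : Datum A M x u)

/-- `∂` carries `G (q+1) s` into `E q s`. [cite: SerreGAGA1956, n° 13] -/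
theorem kdA_mem (q : ℕ) : ∀ s, ∀ v ∈ D.G (q + 1) s, kdA A x q v ∈ D.E q s :=
  fun s v hv => (D.mem_E q s _).2 ⟨D.kd_mem q s v hv, kd_mem_cycles x v⟩


/-- **The short complex `0 → Č(E (q+1)) → Č(G (q+1)) → Č(E q) → 0`** of ordered Čech complexes
(inclusion, then `∂`). [cite: SerreGAGA1956, n° 13] -/
def ses (q : ℕ) : ShortComplex (CochainComplex (ModuleCat.{v} A) ℤ) :=
  familySC (kdA A x q) (D.kdA_mem q) (D.monoG (q + 1)) (D.monoE q) (D.monoE (q + 1)) LinearMap.id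
    (fun s v hv => D.E_le_G (q + 1) s hv)
    (fun s v hv => by
      rw [LinearMap.id_apply]
      exact (mem_cycles_succ x).1 ((D.mem_E (q + 1) s v).1 hv).2)

/-- The objects of `ses`. [cite: SerreGAGA1956, n° 13] -/
@[simp] theorem ses_X₁ (q : ℕ) : (D.ses q).X₁ = D.kerCx (q + 1) := rfl

/-- See `ses_X₁`. [cite: SerreGAGA1956, n° 13] -/
@[simp] theorem ses_X₂ (q : ℕ) : (D.ses q).X₂ = D.freeCx (q + 1) := rfl

/-- See `ses_X₁`. [cite: SerreGAGA1956, n° 13] -/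
@[simp] theorem ses_X₃ (q : ℕ) : (D.ses q).X₃ = D.kerCx q := rfl

/-- **The short complex is short exact** when `u_i x_i = 1` for all `i`: on each `U_s` (`s ≠ ∅`, the
only sets the ordered Čech complex sees) a cycle `w ∈ E q s` is `∂` of its cone `h_{u_i, i} w ∈
G (q+1) s` for any vertex `i ∈ s`. (Exactness of complexes of modules is checked degreewise, Mathlib
`HomologicalComplex.shortExact_of_degreewise_shortExact`.) [cite: SerreGAGA1956, n° 13]
[cite: GortzWedhorn2023, Rem. 22.87] -/
theorem shortExact_ses (hu : ∀ i, u i * x i = 1) (q : ℕ) : (D.ses q).ShortExact := by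
  apply HomologicalComplex.shortExact_of_degreewise_shortExact
  intro n
  apply ModuleCat.shortComplex_shortExact
  · -- exactness in the middle
    intro g
    constructor
    · intro hg
      change Cochain.map (kdA A x q) (D.kdA_mem q) n g = 0 at hg
      have hw : ∀ σ : Simplex ι n, ((g σ : Sub ι (q + 1) → M)) ∈ D.E (q + 1) σ.1 := fun σ => by
        refine (D.mem_E (q + 1) σ.1 _).2 ⟨(g σ).2, (mem_cycles_succ x).2 ?_⟩
        have := congr_arg (fun c : Cochain (D.E q) n => (c σ : Sub ι q → M)) hg
        exact this
      refine ⟨fun σ => ⟨(g σ : Sub ι (q + 1) → M), hw σ⟩, ?_⟩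
      change Cochain.map LinearMap.id (fun s v hv => D.E_le_G (q + 1) s hv) n _ = g
      exact funext fun σ => Subtype.ext rfl
    · rintro ⟨g', rfl⟩
      change Cochain.map (kdA A x q) (D.kdA_mem q) n
        (Cochain.map LinearMap.id (fun s v hv => D.E_le_G (q + 1) s hv) n g') = 0
      funext σ; apply Subtype.ext
      rw [Cochain.coe_map_apply, Cochain.coe_map_apply, LinearMap.id_apply]
      exact (mem_cycles_succ x).1 ((D.mem_E (q + 1) σ.1 _).1 (g' σ).2).2
  · exact Cochain.map_injective LinearMap.id (fun s v hv => D.E_le_G (q + 1) s hv)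
      fun s v _ hv => hv
  · -- surjectivity: the cone from a vertex of the (nonempty) simplex
    intro g
    have hsec : ∀ σ : Simplex ι n, ∃ v ∈ D.G (q + 1) σ.1, kdA A x q v = (g σ : Sub ι q → M) := by
      intro σ
      obtain ⟨i, hi⟩ := σ.2.1
      obtain ⟨hG, hZ⟩ := (D.mem_E q σ.1 _).1 (g σ).2
      exact ⟨kh (u i) i q (g σ : Sub ι q → M), D.kh_mem q σ.1 i hi _ hG,
        kd_kh_of_mem_cycles x (u i) i (hu i) hZ⟩
    choose v hv hdv using hsec
    exact ⟨fun σ => ⟨v σ, hv σ⟩, funext fun σ => Subtype.ext (hdv σ)⟩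

end Datum

/-! ### Morphisms of data and the comparison maps -/

variable {M' : Type v} [AddCommGroup M'] [Module R M'] [Module A M'] [IsScalarTower A R M']

variable {x u}

/-- **A morphism of Koszul–Čech data**: an `R`-linear map `ψ : M → M'` (commuting with `∂` and the
cones, `kd_compLeft` / `kh_compLeft`) carrying the sections `G q s` into `G' q s` (e.g. Serre's
evaluation of algebraic sections as holomorphic ones). [cite: SerreGAGA1956, n° 13] -/
structure Datum.Hom (D : Datum A M x u) (D' : Datum A M' x u) where
  /-- The underlying `R`-linear map. -/
  ψ : M →ₗ[R] M'
  /-- It carries sections to sections. -/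
  mapsTo : ∀ q s, ∀ v ∈ D.G q s, ψ.compLeft (Sub ι q) v ∈ D'.G q s

namespace Datum.Hom

variable {D : Datum A M x u} {D' : Datum A M' x u} (f : D.Hom D')

/-- The coordinatewise map on `q`-chains, `A`-linearly. [folklore] -/
abbrev ψA (q : ℕ) : (Sub ι q → M) →ₗ[A] (Sub ι q → M') := (f.ψ.compLeft (Sub ι q)).restrictScalars A

/-- `ψ` carries kernel sections to kernel sections. [cite: SerreGAGA1956, n° 13] -/
theorem mapsTo_E (q : ℕ) : ∀ s, ∀ v ∈ D.E q s, f.ψA q v ∈ D'.E q s := fun s v hv => by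
  obtain ⟨hG, hZ⟩ := (D.mem_E q s v).1 hv
  exact (D'.mem_E q s _).2 ⟨f.mapsTo q s v hG, compLeft_mem_cycles x f.ψ hZ⟩

/-- **The comparison map of the free complexes** `Č(G q) → Č(G' q)`. [cite: SerreGAGA1956, n° 13] -/
def freeMap (q : ℕ) : D.freeCx q ⟶ D'.freeCx q :=
  complexMap (f.ψA q) (f.mapsTo q) (D.monoG q) (D'.monoG q)

/-- **The comparison map of the kernel complexes** `Č(E q) → Č(E' q)`. [cite: SerreGAGA1956, n° 13] -/
def kerMap (q : ℕ) : D.kerCx q ⟶ D'.kerCx q :=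
  complexMap (f.ψA q) (f.mapsTo_E q) (D.monoE q) (D'.monoE q)

omit [Fintype ι] in
/-- Two composites of `complexMap`s agree when the underlying linear maps agree on members.
[cite: GortzWedhorn2023, (21.14)–(21.15)] -/
theorem complexMap_comp_eq {𝕂₁ 𝕂₂ 𝕂₃ 𝕂₂' : Type v} [AddCommGroup 𝕂₁] [Module A 𝕂₁]
    [AddCommGroup 𝕂₂] [Module A 𝕂₂] [AddCommGroup 𝕂₃] [Module A 𝕂₃] [AddCommGroup 𝕂₂']
    [Module A 𝕂₂'] {F₁ : Finset ι → Submodule A 𝕂₁} {F₂ : Finset ι → Submodule A 𝕂₂}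
    {F₃ : Finset ι → Submodule A 𝕂₃} {F₂' : Finset ι → Submodule A 𝕂₂'} (h₁ : Monotone F₁)
    (h₂ : Monotone F₂) (h₃ : Monotone F₃) (h₂' : Monotone F₂') (a : 𝕂₁ →ₗ[A] 𝕂₂)
    (ha : ∀ s, ∀ v ∈ F₁ s, a v ∈ F₂ s) (b : 𝕂₂ →ₗ[A] 𝕂₃) (hb : ∀ s, ∀ v ∈ F₂ s, b v ∈ F₃ s)
    (c : 𝕂₁ →ₗ[A] 𝕂₂') (hc : ∀ s, ∀ v ∈ F₁ s, c v ∈ F₂' s) (d : 𝕂₂' →ₗ[A] 𝕂₃)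
    (hd : ∀ s, ∀ v ∈ F₂' s, d v ∈ F₃ s) (h : ∀ s, ∀ v ∈ F₁ s, b (a v) = d (c v)) :
    complexMap a ha h₁ h₂ ≫ complexMap b hb h₂ h₃ = complexMap c hc h₁ h₂' ≫ complexMap d hd h₂' h₃ := by
  ext n g
  change Cochain.map b hb n (Cochain.map a ha n g) = Cochain.map d hd n (Cochain.map c hc n g)
  funext σ; apply Subtype.ext
  simp only [Cochain.coe_map_apply]
  exact h σ.1 _ (g σ).2

/-- **The morphism of short exact sequences** induced by `ψ` (it commutes with the inclusions
trivially and with `∂` by `kd_compLeft`). [cite: SerreGAGA1956, n° 13] -/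
def sesMap (q : ℕ) : D.ses q ⟶ D'.ses q :=
  ShortComplex.homMk (f.kerMap (q + 1)) (f.freeMap (q + 1)) (f.kerMap q)
    (complexMap_comp_eq _ _ _ _ _ _ _ _ _ _ _ _ fun s v _ => rfl)
    (complexMap_comp_eq _ _ _ _ _ _ _ _ _ _ _ _ fun s v _ => by
      change kd x q (f.ψ.compLeft _ v) = f.ψ.compLeft _ (kd x q v)
      exact kd_compLeft x f.ψ q v)

/-- **The dévissage step** (Serre, n° 13: the two long exact cohomology sequences and the five
lemma — Mathlib `HomologicalComplex.HomologySequence.quasiIso_τ₃`): if the comparison maps of the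
kernel complexes in degree `q + 1` and of the free complexes in degree `q + 1` are
quasi-isomorphisms, so is the comparison map of the kernel complexes in degree `q`.
[cite: SerreGAGA1956, n° 13] -/
theorem quasiIso_kerMap_of_succ (hu : ∀ i, u i * x i = 1) (q : ℕ)
    (h₁ : QuasiIso (f.kerMap (q + 1))) (h₂ : QuasiIso (f.freeMap (q + 1))) :
    QuasiIso (f.kerMap q) :=
  HomologicalComplex.HomologySequence.quasiIso_τ₃ (f.sesMap q) (D.shortExact_ses hu q)
    (D'.shortExact_ses hu q) h₁ h₂

/-- Beyond the top degree the kernel complexes vanish, so the comparison map is a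
quasi-isomorphism for trivial reasons. [cite: SerreGAGA1956, n° 13] -/
theorem quasiIso_kerMap_of_card_lt {q : ℕ} (hq : Fintype.card ι < q) : QuasiIso (f.kerMap q) := by
  rw [quasiIso_iff]
  intro n
  exact (quasiIsoAt_iff_exactAt (f.kerMap q) n
    (HomologicalComplex.ExactAt.of_isZero (D.isZero_kerCx_X hq n))).2
    (HomologicalComplex.ExactAt.of_isZero (D'.isZero_kerCx_X hq n))

/-- **Two out of three, all degrees: if every comparison map of free complexes is a
quasi-isomorphism, so is every comparison map of kernel complexes** — by descending induction on
`q` from `q > #ι` (Serre's "récurrence descendante"). [cite: SerreGAGA1956, n° 13] -/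
theorem quasiIso_kerMap (hu : ∀ i, u i * x i = 1) (hfree : ∀ q, QuasiIso (f.freeMap q)) (q : ℕ) :
    QuasiIso (f.kerMap q) := by
  -- descending induction: `∀ q, #ι < q + k → QuasiIso (kerMap q)` by induction on `k`
  suffices h : ∀ k q, Fintype.card ι < q + k → QuasiIso (f.kerMap q) from
    h (Fintype.card ι + 1) q (by omega)
  intro k
  induction k with
  | zero => intro q hq; exact f.quasiIso_kerMap_of_card_lt (by omega)
  | succ k ih =>
    intro q hq
    exact f.quasiIso_kerMap_of_succ hu q (ih (q + 1) (by omega)) (hfree (q + 1))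

/-- The induced isomorphisms on Čech cohomology of the kernel complexes, all degrees. [cite: SerreGAGA1956, n° 13] -/
theorem isIso_homologyMap_kerMap (hu : ∀ i, u i * x i = 1) (hfree : ∀ q, QuasiIso (f.freeMap q))
    (q : ℕ) (n : ℤ) : IsIso (HomologicalComplex.homologyMap (f.kerMap q) n) := by
  haveI := f.quasiIso_kerMap hu hfree q
  infer_instance

end Datum.Hom

end Families

end KoszulCech

end Literature.Algebra.Homology
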